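import Mathlib.Analysis.SpecialFunctions.Trigonometric.Basic
import Mathlib.Analysis.SpecialFunctions.Sqrt
import Mathlib.Data.Fin.VecNotation
import HarnessLib

/-!
# The nine face weights of the dilute `A₂⁽²⁾` loop model at the percolation point `λ = π/3`

Cite item `wi-13666` (routes `CriticalPhenomena/CardyFormulaZ2`: `CardyDiluteOrbit`,
`CardyIKTransport`, `CardyCornerFugacity`, `CardyPerronTeleport`; the one-parameter family of
Nienhuis/Izergin–Korepin `n = 1` weights through critical site percolation on the triangular lattice).

Source: A. Morin-Duchesne, A. Klümper, P. A. Pearce, *Critical site percolation on the triangular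
lattice: from integrability to conformal partition functions*, J. Stat. Mech. (2023) 043103 =
arXiv:2211.12379 [MorinDuchesneKlumperPearce2023] (read: §3.1 eq. (face.op) p. 8, §1.1 p. 5, §3.6
pp. 10–11). The face operator of the general dilute `A₂⁽²⁾` loop model is the combination of nine
tiles with local Boltzmann weights (§3.1)
`ρ₁ = s(2λ)s(3λ) + s(u)s(3λ−u)`, `ρ₂ = ρ₃ = s(2λ)s(3λ−u)`, `ρ₄ = ρ₅ = s(2λ)s(u)`,
`ρ₆ = ρ₇ = s(u)s(3λ−u)`, `ρ₈ = s(2λ−u)s(3λ−u)`, `ρ₉ = −s(u)s(λ−u)`, `s(x) = sin x / sin λ`, loop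
fugacity `β = −2 cos 4λ`. At the percolation point `λ = π/3` (`β = 1`; §3.6: "This corresponds to the
special point `λ = u = π/3`"), `s(3λ) = 0`, `s(2λ) = 1` and `s(3λ − u) = s(u)`, so — multiplying by the
positive constant `sin²(π/3) = 3/4` to clear denominators, an overall normalisation that changes no
probability — the nine weights are the functions of the spectral parameter `u` recorded here:
`ρ₁ = sin²u` (vacancy), `ρ₂ = ⋯ = ρ₅ = (√3/2) sin u` (one arc, turning), `ρ₆ = ρ₇ = sin²u` (one arc,
straight), `ρ₈ = sin u · sin(2π/3 − u)`, `ρ₉ = sin u · sin(u − π/3)` (two arcs). The isotropic point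
of the `A₂⁽²⁾` model is `u = 3λ/2` (§1.1), here `u = π/2`.

Everything in this file is a DEFINITION or a PROVED theorem (no named fact):

* `faceWeight u : Fin 9 → ℝ` — the nine weights above [cite MDKP §3.1 at λ = π/3];
  `cornerFugacity u = √3/(2 sin u)` and `saddleBias u = sin(2π/3 − u)/sin u` — the "colouring
  coordinates" `t(u)`, `b(u)` used by the routes (ratios `ρ₂/ρ₁`-type normalisations).
* `faceWeight_nonneg_of_mem_Icc`, `faceWeight_nonneg_iff` — all nine weights are `≥ 0` for
  `u ∈ [π/3, 2π/3]`, and for `0 < u < π` ONLY there (at `u ∈ {0, π}` all weights vanish, so the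
  restriction `0 < u < π` is needed for "only if").
* `faceWeight_pi_div_three` — at `u = π/3`: `ρ₉ = 0` and the other eight weights equal `3/4`
  (MDKP §3.6: "At `u = π/3`, the weight of the last tile vanishes, and the weights of the remaining
  eight tiles are all equal" — to `1` in their normalisation, `3/4` in ours); this is the point that
  the Fehér–Nienhuis map and a shear identify with critical site percolation on the triangular
  lattice (MDKP §2.2, §3.6 — a statement about the loop MODEL, not formalised here).
* `faceWeight_pi_div_two` — at the isotropic point `u = π/2` the weights are
  `(1, √3/2, √3/2, √3/2, √3/2, 1, 1, 1/2, 1/2)`.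
* `cornerFugacity_sq_sub_sq` — the family lies on the hyperbola `t² − (b − 1/2)² = 3/4`
  (`sin u ≠ 0`).

NOT here: the transfer matrices `T(u)`, `D(u)` and their commutation (Yang–Baxter equation for the
Izergin–Korepin `R`-matrix; MDKP §3.4–3.5), and the model identification with site percolation —
these need the loop-model / dilute Temperley–Lieb vocabulary, absent from the tree.
-/

noncomputable section

open Real

namespace Literature.Probability.LatticeModels.DiluteA22

/-- **The nine face weights of the dilute `A₂⁽²⁾` loop model at `λ = π/3`**, as functions of the
spectral parameter `u`, in the normalisation `sin²λ ×` (MDKP's `λ → π/3` weights of §3.1/§3.6):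
`(sin²u, (√3/2) sin u ×4, sin²u ×2, sin u sin(2π/3 − u), sin u sin(u − π/3))` — indices `0, …, 8`
for MDKP's tiles `1, …, 9` (vacancy; four one-arc turning tiles; two one-arc straight tiles; the two
two-arc tiles). [cite: MorinDuchesneKlumperPearce2023, §3.1 eq. (face.op) at λ = π/3 and §3.6] -/
def faceWeight (u : ℝ) : Fin 9 → ℝ :=
  ![sin u ^ 2, √3 / 2 * sin u, √3 / 2 * sin u, √3 / 2 * sin u, √3 / 2 * sin u,
    sin u ^ 2, sin u ^ 2, sin u * sin (2 * π / 3 - u), sin u * sin (u - π / 3)]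

/-- The **corner fugacity** `t(u) = ρ₂/ρ₁ = √3/(2 sin u)` (colouring coordinate of the routes
`CardyFormulaZ2/*`). [cite: MorinDuchesneKlumperPearce2023, §3.6 (normalised face operator)] -/
def cornerFugacity (u : ℝ) : ℝ := √3 / (2 * sin u)

/-- The **saddle bias** `b(u) = ρ₈/ρ₁ = sin(2π/3 − u)/sin u` (colouring coordinate of the routes
`CardyFormulaZ2/*`). [cite: MorinDuchesneKlumperPearce2023, §3.6 (normalised face operator)] -/
def saddleBias (u : ℝ) : ℝ := sin (2 * π / 3 - u) / sin u

/-! ### Unfolding -/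

/-- Unfolding entry `zero` of `faceWeight`. [folklore] -/
@[simp] theorem faceWeight_zero (u : ℝ) : faceWeight u 0 = sin u ^ 2 := rfl
/-- Unfolding entry `one` of `faceWeight`. [folklore] -/
@[simp] theorem faceWeight_one (u : ℝ) : faceWeight u 1 = √3 / 2 * sin u := rfl
/-- Unfolding entry `two` of `faceWeight`. [folklore] -/
@[simp] theorem faceWeight_two (u : ℝ) : faceWeight u 2 = √3 / 2 * sin u := rfl
/-- Unfolding entry `three` of `faceWeight`. [folklore] -/
@[simp] theorem faceWeight_three (u : ℝ) : faceWeight u 3 = √3 / 2 * sin u := rfl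
/-- Unfolding entry `four` of `faceWeight`. [folklore] -/
@[simp] theorem faceWeight_four (u : ℝ) : faceWeight u 4 = √3 / 2 * sin u := rfl
/-- Unfolding entry `five` of `faceWeight`. [folklore] -/
@[simp] theorem faceWeight_five (u : ℝ) : faceWeight u 5 = sin u ^ 2 := rfl
/-- Unfolding entry `six` of `faceWeight`. [folklore] -/
@[simp] theorem faceWeight_six (u : ℝ) : faceWeight u 6 = sin u ^ 2 := rfl
/-- Unfolding entry `seven` of `faceWeight`. [folklore] -/
@[simp] theorem faceWeight_seven (u : ℝ) : faceWeight u 7 = sin u * sin (2 * π / 3 - u) := rfl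
/-- Unfolding entry `eight` of `faceWeight`. [folklore] -/
@[simp] theorem faceWeight_eight (u : ℝ) : faceWeight u 8 = sin u * sin (u - π / 3) := rfl

/-- The nine nonnegativity conditions reduce to four. [folklore] -/
theorem forall_faceWeight_nonneg_iff (u : ℝ) :
    (∀ i, 0 ≤ faceWeight u i) ↔
      0 ≤ √3 / 2 * sin u ∧ 0 ≤ sin u * sin (2 * π / 3 - u) ∧ 0 ≤ sin u * sin (u - π / 3) := by
  constructor
  · intro h
    exact ⟨h 1, h 7, h 8⟩
  · rintro ⟨h1, h7, h8⟩ i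
    fin_cases i <;> simp [sq_nonneg, h1, h7, h8]

/-! ### (a) Nonnegativity exactly on `[π/3, 2π/3]` -/

/-- `sin (2π/3) = √3/2`. [folklore] -/
theorem sin_two_pi_div_three : sin (2 * π / 3) = √3 / 2 := by
  rw [show 2 * π / 3 = π - π / 3 by ring, sin_pi_sub, sin_pi_div_three]

/-- `cos (2π/3) = -1/2`. [folklore] -/
theorem cos_two_pi_div_three : cos (2 * π / 3) = -1 / 2 := by
  rw [show 2 * π / 3 = π - π / 3 by ring, cos_pi_sub, cos_pi_div_three]
  norm_num

/-- **(a), "if"**: for `π/3 ≤ u ≤ 2π/3` all nine weights are nonnegative. [cite: MorinDuchesneKlumperPearce2023, §3.6] -/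
theorem faceWeight_nonneg_of_mem_Icc {u : ℝ} (hu : u ∈ Set.Icc (π / 3) (2 * π / 3)) (i : Fin 9) :
    0 ≤ faceWeight u i := by
  obtain ⟨h1, h2⟩ := hu
  have hpi : 0 < π := pi_pos
  have hsin : 0 ≤ sin u := sin_nonneg_of_nonneg_of_le_pi (by linarith) (by linarith)
  have h8 : 0 ≤ sin (2 * π / 3 - u) := sin_nonneg_of_nonneg_of_le_pi (by linarith) (by linarith)
  have h9 : 0 ≤ sin (u - π / 3) := sin_nonneg_of_nonneg_of_le_pi (by linarith) (by linarith)
  revert i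
  rw [forall_faceWeight_nonneg_iff]
  exact ⟨by positivity, mul_nonneg hsin h8, mul_nonneg hsin h9⟩

/-- **(a), "iff"**: for `0 < u < π` (where `sin u > 0`; at `u ∈ {0, π}` all nine weights vanish) the
nine weights are all nonnegative EXACTLY when `π/3 ≤ u ≤ 2π/3` — `ρ₉ ≥ 0` forces `u ≥ π/3` and
`ρ₈ ≥ 0` forces `u ≤ 2π/3`. [cite: MorinDuchesneKlumperPearce2023, §3.1 eq. (face.op) at λ = π/3] -/
theorem faceWeight_nonneg_iff {u : ℝ} (hu0 : 0 < u) (hupi : u < π) :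
    (∀ i, 0 ≤ faceWeight u i) ↔ u ∈ Set.Icc (π / 3) (2 * π / 3) := by
  refine ⟨fun h => ?_, fun h => faceWeight_nonneg_of_mem_Icc h⟩
  rw [forall_faceWeight_nonneg_iff] at h
  obtain ⟨-, h8, h9⟩ := h
  have hsin : 0 < sin u := sin_pos_of_pos_of_lt_pi hu0 hupi
  have h8' : 0 ≤ sin (2 * π / 3 - u) := nonneg_of_mul_nonneg_right h8 hsin
  have h9' : 0 ≤ sin (u - π / 3) := nonneg_of_mul_nonneg_right h9 hsin
  constructor
  · by_contra hlt
    push Not at hlt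
    have : sin (u - π / 3) < 0 := sin_neg_of_neg_of_neg_pi_lt (by linarith) (by linarith [pi_pos])
    linarith
  · by_contra hlt
    push Not at hlt
    have : sin (2 * π / 3 - u) < 0 := sin_neg_of_neg_of_neg_pi_lt (by linarith) (by linarith)
    linarith

/-! ### (b) The percolation point `u = π/3` and (c) the isotropic point `u = π/2` -/

/-- **(b)** At `u = λ = π/3` the ninth weight vanishes and the other eight are equal, to `3/4`
(MDKP §3.6: "the weight of the last tile vanishes, and the weights of the remaining eight tiles are
all equal" — to `1` after their division by `s(u)`); the point identified with critical site
percolation on the triangular lattice. [cite: MorinDuchesneKlumperPearce2023, §3.6] -/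
theorem faceWeight_pi_div_three :
    faceWeight (π / 3) = ![3 / 4, 3 / 4, 3 / 4, 3 / 4, 3 / 4, 3 / 4, 3 / 4, 3 / 4, 0] := by
  have h3 : (√3 / 2) ^ 2 = (3 : ℝ) / 4 := by
    rw [div_pow, sq_sqrt (by norm_num : (0 : ℝ) ≤ 3)]; norm_num
  have h3' : √3 / 2 * (√3 / 2) = (3 : ℝ) / 4 := by rw [← sq, h3]
  have e : 2 * π / 3 - π / 3 = π / 3 := by ring
  ext i
  fin_cases i <;> simp [e, h3, h3']

/-- **(c)** At the isotropic point `u = 3λ/2 = π/2` (MDKP §1.1) the weights are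
`(1, √3/2, √3/2, √3/2, √3/2, 1, 1, 1/2, 1/2)`. [cite: MorinDuchesneKlumperPearce2023, §1.1 (isotropic point u = 3λ/2)] -/
theorem faceWeight_pi_div_two :
    faceWeight (π / 2) = ![1, √3 / 2, √3 / 2, √3 / 2, √3 / 2, 1, 1, 1 / 2, 1 / 2] := by
  have e1 : 2 * π / 3 - π / 2 = π / 6 := by ring
  have e2 : π / 2 - π / 3 = π / 6 := by ring
  ext i
  fin_cases i <;> simp [e1, e2, sin_pi_div_six]

/-! ### (d) The hyperbola in colouring coordinates -/

/-- `b(u) - 1/2 = (√3/2) cot u` (`sin u ≠ 0`). [folklore] -/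
theorem saddleBias_sub_half {u : ℝ} (hu : sin u ≠ 0) :
    saddleBias u - 1 / 2 = √3 / 2 * (cos u / sin u) := by
  unfold saddleBias
  rw [sin_sub, sin_two_pi_div_three, cos_two_pi_div_three]
  field_simp
  ring

/-- **(d)** The one-parameter family lies on the hyperbola `t(u)² − (b(u) − 1/2)² = 3/4` in the
colouring coordinates `t = cornerFugacity`, `b = saddleBias` (for `sin u ≠ 0`): `t² = 3/(4 sin²u)`,
`(b − 1/2)² = (3/4) cos²u / sin²u`, and `sin² + cos² = 1`. [folklore] -/
theorem cornerFugacity_sq_sub_sq {u : ℝ} (hu : sin u ≠ 0) :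
    cornerFugacity u ^ 2 - (saddleBias u - 1 / 2) ^ 2 = 3 / 4 := by
  rw [saddleBias_sub_half hu]
  unfold cornerFugacity
  have h3 : (√3) ^ 2 = 3 := sq_sqrt (by norm_num)
  field_simp
  rw [h3]
  nlinarith [sin_sq_add_cos_sq u]

/-- At the isotropic point the colouring coordinates are `t = √3/2`, `b = 1/2` (so that
`p_IK = t/(1+t) = 2√3 − 3` in the routes' notation). [folklore] -/
theorem cornerFugacity_pi_div_two : cornerFugacity (π / 2) = √3 / 2 := by
  simp [cornerFugacity]

/-- `b(π/2) = 1/2`. [folklore] -/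
theorem saddleBias_pi_div_two : saddleBias (π / 2) = 1 / 2 := by
  rw [saddleBias, show 2 * π / 3 - π / 2 = π / 6 by ring, sin_pi_div_six, sin_pi_div_two, div_one]

end Literature.Probability.LatticeModels.DiluteA22

end
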